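import Summits.CriticalPhenomena.PercolationContinuityZ3.Theses.PercShatteringRace

/-!
# Sketch (crux-ideate round 2, ideator 4) — crux stmt-CriticalPhenomena-5785 `NearLinearTwoClusterDecay`

First-lemma signatures for the idea card `worlds-split-density-sampling` and for the memo
`LeverCensus-ideator4-r2.md`. Everything is a `def : Prop` (statements), plus two proved
one-liners (`crux_of_worlds`, `cruxJumpWorld_of_crux`). Nothing here is a skeleton.
-/

namespace Summit.CriticalPhenomena.PercolationContinuityZ3.Cruxes.NearLinearTwoClusterDecay.WorldsSplitR2

open MeasureTheory Filter Topology
open Literature.Probability.LatticeModels Literature.Probability.Percolation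
open Summit.CriticalPhenomena.PercolationContinuityZ3.Theses.PercShatteringRace

noncomputable section

/-- The critical bond measure `P_{p_c}` on `ℤ³`. -/
abbrev Pc : Measure (BondConfig (Site 3)) := bondPercolation (zdGraph 3) (criticalProbI 3)

/-- `θ(p_c)`. -/
abbrev thetaC : ℝ := theta (zdGraph 3) 0 (criticalProbI 3)

/-- The crux's outer radius `m = ⌈n^{7/6}⌉`. -/
def outer (n : ℕ) : ℕ := ⌈(n : ℝ) ^ ((7 : ℝ) / 6)⌉₊

/-- `x` reaches the inner vertex boundary of `Λ(m)` by an open path inside `Λ(m)`. -/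
def reachesOut (m : ℕ) (x : Site 3) : Set (BondConfig (Site 3)) :=
  {ω | ∃ y ∈ innerBoundary (zdGraph 3) (box 3 m), ω ∈ openConnIn ↑(box 3 m) x y}

/-- PAIR form of the crux event for a deterministic pair: both reach `∂ⁱⁿΛ(m)` inside `Λ(m)`,
not joined inside `Λ(m)` (= Cerf's pair two-arms event; `UniquenessZone.badPair` pattern). -/
def pairBad (m : ℕ) (x x' : Site 3) : Set (BondConfig (Site 3)) :=
  reachesOut m x ∩ reachesOut m x' ∩ (openConnIn ↑(box 3 m) x x')ᶜ

/-- The union-form crux event, as in the route decl, at inner radius `n`, outer radius `m`. -/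
def twoCluster (n m : ℕ) : Set (BondConfig (Site 3)) :=
  {ω | ∃ x ∈ box 3 n, ∃ x' ∈ box 3 n, ω ∈ pairBad m x x'}

/-- The crux is the diagonal `m = outer n` of `twoCluster` (definitional up to unfolding). -/
def CruxUnfolds : Prop :=
  NearLinearTwoClusterDecay ↔ Tendsto (fun n : ℕ => Pc.real (twoCluster n (outer n))) atTop (𝓝 0)

/-- Inner trace: number of points of `Λ(n)` joined to `x` inside `Λ(m)` (the `Λ(n)`-density of
the `Λ(m)`-cluster of `x`). -/
def innerTrace (n m : ℕ) (ω : BondConfig (Site 3)) (x : Site 3) : ℕ :=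
  Set.ncard {y : Site 3 | y ∈ box 3 n ∧ ω ∈ openConnIn ↑(box 3 m) x y}

/-! ## The three stubs of the worlds split -/

/-- S1 (what `closes` consumes, memo-5785 `JumpPairDecay` at α = 7/6): in a jump world the PAIR
two-cluster probability at aspect 7/6 tends to 0 uniformly over pairs of `Λ(n)`. -/
def JumpPairDecay : Prop :=
  0 < thetaC → ∀ ε : ℝ, 0 < ε → ∀ᶠ n : ℕ in atTop,
    ∀ x ∈ box 3 n, ∀ x' ∈ box 3 n, Pc.real (pairBad (outer n) x x') ≤ ε

/-- S2 (NEW, typed here): jump-world NO THIN STRANDS / NO DUST — in a jump world, with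
probability → 1 every `Λ(m)`-cluster that meets `Λ(n)` and reaches `∂ⁱⁿΛ(m)` is `κ`-dense in
`Λ(n)`. Thin strands of `C_∞` and long finite "dust" clusters both violate it; the union-form
crux REQUIRES it (see `CruxKillsThinStrands`). -/
def JumpNoThinStrands : Prop :=
  0 < thetaC → ∀ ε : ℝ, 0 < ε → ∃ κ : ℝ, 0 < κ ∧ ∀ᶠ n : ℕ in atTop,
    Pc.real {ω | ∃ x ∈ box 3 n, ω ∈ reachesOut (outer n) x ∧
      (innerTrace n (outer n) ω x : ℝ) < κ * (box 3 n).card} ≤ ε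

/-- S3: the `θ(p_c) = 0`-world half of the crux (the hyperscaling-lite residue; false in
`d ≥ 7`, `Literature.Barriers.CriticalPhenomena.SpanningClustersAboveSix`; engines: NP_M⁰ by the landed shell
product, or X_B⁰ by the landed edge 0846 ⇒ 5785 — both relativised to `θ(p_c) = 0`). -/
def CruxNullWorld : Prop := thetaC = 0 → NearLinearTwoClusterDecay

/-- The jump-world half (certified equivalent of what the route consumes up to the union/pair
gap: `Theorems…JumpForm.nearLinearTwoClusterDecay_iff_worlds`, p125606). -/
def CruxJumpWorld : Prop := 0 < thetaC → NearLinearTwoClusterDecay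

/-- Glue of the split (pure logic, `θ(p_c) ≥ 0`). -/
theorem crux_of_worlds (h0 : CruxNullWorld) (h1 : CruxJumpWorld) : NearLinearTwoClusterDecay := by
  rcases lt_or_eq_of_le (show (0 : ℝ) ≤ thetaC from measureReal_nonneg) with h | h
  · exact h1 h
  · exact h0 h.symm

/-- Trivial converse used by the disprover-side consequence below. -/
theorem cruxJumpWorld_of_crux (h : NearLinearTwoClusterDecay) : CruxJumpWorld := fun _ => h

/-! ## The lever: density sampling (union form ⇐ pair form + no thin strands) -/

/-- FIRST LEMMA (provable now; Markov on the number of bad pairs): dense distinct strands are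
caught by pair statistics — if two `κ`-dense (in `Λ(n)`) clusters of `Λ(m)` reach `∂ⁱⁿΛ(m)`
distinctly, at least `(κ|Λ(n)|)²` ordered pairs `(y,y') ∈ Λ(n)²` lie in `pairBad m y y'`. -/
def PairCountBound : Prop :=
  ∀ (n m : ℕ) (κ : ℝ), 0 < κ →
    Pc.real {ω | ∃ x ∈ box 3 n, ∃ x' ∈ box 3 n, ω ∈ pairBad m x x' ∧
        κ * (box 3 n).card ≤ (innerTrace n m ω x : ℝ) ∧ κ * (box 3 n).card ≤ (innerTrace n m ω x' : ℝ)}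
      ≤ (κ * (box 3 n).card)⁻¹ ^ 2 * ∑ y ∈ box 3 n, ∑ y' ∈ box 3 n, Pc.real (pairBad m y y')

/-- DENSITY SAMPLING (provable now from `PairCountBound` + the dichotomy thin/dense):
S1 ∧ S2 ⇒ the jump half of the crux. -/
def DensitySampling : Prop := JumpPairDecay → JumpNoThinStrands → CruxJumpWorld

/-- The whole split: S1 ∧ S2 ∧ S3 ⇒ crux (by `DensitySampling` and `crux_of_worlds`). -/
def WorldsSplit : Prop := JumpPairDecay → JumpNoThinStrands → CruxNullWorld → NearLinearTwoClusterDecay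

/-! ## Disprover-side consequence: the union form REQUIRES killing jump-world dust -/

/-- Long finite dust at the crux's scales: some `x ∈ Λ(n)` reaches `∂ⁱⁿΛ(⌈n^{7/6}⌉)` inside the
box although its cluster is finite. -/
def dustEvt (n : ℕ) : Set (BondConfig (Site 3)) :=
  {ω | ∃ x ∈ box 3 n, ω ∈ reachesOut (outer n) x ∧ ω ∉ percolatesAt x}

/-- `U` kills jump-world dust (provable now: on `dustEvt n ∩ {C_∞ meets Λ(n)}` the crux event
occurs — a point of `C_∞ ∩ Λ(n)` reaches `∂ⁱⁿΛ(m)` inside `Λ(m)` by first exit and is not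
joined to the finite cluster — and `P(C_∞ ∩ Λ(n) = ∅) → 0` when `θ(p_c) > 0` by continuity
of measure and the zero–one law). Reading: ANY proof of the crux as filed proves, inside the
counterfactual jump world, that finite critical clusters reaching distance `n^{7/6}` from `Λ(n)`
have probability `o(1)` — in particular `P(n^{7/6} ≤ rad C(0) < ∞) = o(n^{-3})` is NOT implied but
the union over `Λ(n)` is; no tool at `p = p_c` controls finite-cluster radii in a percolating
world (Grimmett 1999 §8.4–8.5 need `p > p_c`). -/
def CruxKillsDust : Prop :=
  NearLinearTwoClusterDecay → 0 < thetaC → Tendsto (fun n : ℕ => Pc.real (dustEvt n)) atTop (𝓝 0)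

/-- Likewise `U` forces S2 in the jump world for the TYPICAL density `κ < θ(p_c)`-fraction? No —
only the dust/strand DICHOTOMY: `U ∧ 0<θ ⇒` w.h.p. at most one `Λ(m)`-cluster meets `Λ(n)` and
`∂ⁱⁿΛ(m)`; recorded as the exact statement. -/
def CruxKillsThinStrands : Prop :=
  NearLinearTwoClusterDecay → 0 < thetaC →
    Tendsto (fun n : ℕ => Pc.real {ω | ∃ x ∈ box 3 n, ∃ x' ∈ box 3 n,
      ω ∈ reachesOut (outer n) x ∧ ω ∈ reachesOut (outer n) x' ∧ ω ∉ openConnIn ↑(box 3 (outer n)) x x'})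
      atTop (𝓝 0)

/-! ## Memo items (LeverCensus-ideator4-r2): statements whose status the memo records -/

/-- Lever 17 (tube confinement), the statement shown CONTINUITY-STRENGTH in the memo: polynomial
decay rate of connections inside tubes of width `ρ` at `p_c`. -/
def TubeDecay : Prop :=
  ∃ A C c : ℝ, 0 < c ∧ ∀ ρ m : ℕ, 1 ≤ ρ →
    Pc.real {ω | ∃ y : Site 3, y 0 = m ∧ ω ∈ openConnIn {v : Site 3 | |v 1| ≤ ρ ∧ |v 2| ≤ ρ} 0 y}
      ≤ C * Real.exp (-(c * m * (ρ : ℝ) ^ (-A)))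

/-- Lever 19 (fat-pair counting), the statement that IS free for `s` above the counting threshold
— but the threshold is `3δ/(δ+1) = d_f` (hyperscaling), not `2`: recorded to prevent re-walking.
`FatPairUniqueness s`: w.h.p. no two distinct `Λ(m)`-clusters of in-box volume `≥ m^s`. -/
def FatPairUniqueness (s : ℝ) : Prop :=
  Tendsto (fun m : ℕ => Pc.real {ω | ∃ x ∈ box 3 m, ∃ x' ∈ box 3 m,
      ω ∉ openConnIn ↑(box 3 m) x x' ∧
      (m : ℝ) ^ s ≤ Set.ncard {y : Site 3 | y ∈ box 3 m ∧ ω ∈ openConnIn ↑(box 3 m) x y} ∧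
      (m : ℝ) ^ s ≤ Set.ncard {y : Site 3 | y ∈ box 3 m ∧ ω ∈ openConnIn ↑(box 3 m) x' y}})
    atTop (𝓝 0)

end

end Summit.CriticalPhenomena.PercolationContinuityZ3.Cruxes.NearLinearTwoClusterDecay.WorldsSplitR2
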